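import Summits.CriticalPhenomena.Ising3DConformalLimit.Theses.FKParityRobustness
import Summits.CriticalPhenomena.Ising3DConformalLimit.Theorems.FKParityRobustnessParityBoundCurrents
import Summits.CriticalPhenomena.Ising3DConformalLimit.Theorems.FKParityRobustnessFarMergingGivesU4
import Literature.Probability.LatticeModels.WeightedCurrents
import Literature.Probability.LatticeModels.IsingTransport
import Literature.Probability.LatticeModels.CriticalCorrWellDefined
import HarnessLib

/-!
# Line `odd-part-fubini` for crux `JoinForcesU4` (stmt-CriticalPhenomena-14627) — FILLED CERTIFICATE

This is the crux-plan skeleton `Lines/odd-part-fubini.lean` with all four registered stubs PROVED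
(no `sorry`): it certifies that every stub signature of the skeleton is correct as stated and that
the composition `JoinForcesU4_of` closes the crux.  The stub statements, the `Registered.*` aliases
and `JoinForcesU4_of` are byte-identical with the skeleton; only the stub bodies differ.

Fillings (credit): S1 = the 3-step Tonelli calc of `SketchIdeator3.lean`
(`tsum_epairWeight_mul_apply_oddParts`, ideator 3); S2, S3, S4 = steps (A), (B) of
`CandidateProof_JoinForcesU4.lean` (ideator 2: `ite_reachable_oddPart_le`, `twoCopyPushforward_holds`
step 4, `strandsJoinBoundShape_holds`, `latticeBoundShape_holds` and its transport lemmas), re-cut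
along this line's stubs; step (C) is the LANDED item 4471
(`FKParityRobustnessFarMergingGivesU4.farMergingGivesU4_proof`).

References: M. Aizenman, Comm. Math. Phys. 86 (1982), Prop. 5.1 [AizenmanCMP1982]; H. Duminil-Copin,
arXiv:1607.06933, Lemma 2.2, Remark 3.4, §4.3 eq. (24) [DuminilCopin2016]; U. T. Hansen, J. Jiang,
F. R. Klausen, arXiv:2506.10765, §2 [HansenJiangKlausen2025]; M. Aizenman, H. Duminil-Copin,
V. Sidoravicius, Comm. Math. Phys. 334 (2015), Thm 1.1 [AizenmanDuminilCopinSidoraviciusCMP2015];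
R. Panis, Ann. Probab. 54 (2026), doi:10.1214/25-aop1782, Prop. 4.7 (additive product form of the
`U₄` identity, vendored as `Current.ursellFour_currentSum_identity`) [Panis2023Triviality].
-/

noncomputable section

namespace Summit.CriticalPhenomena.Ising3DConformalLimit.Cruxes.JoinForcesU4.OddPartFubini

open scoped BigOperators symmDiff ENNReal Topology
open Finset Filter Literature.Probability.LatticeModels
open Summit.CriticalPhenomena.Ising3DConformalLimit.Theses.FKParityRobustness
open Summit.CriticalPhenomena.Ising3DConformalLimit.Cruxes.ParityRobustMerging.PlaquetteXorSurgery
  (tetra tetra_inj)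
open Summit.CriticalPhenomena.Ising3DConformalLimit.Theorems
  (tsum_sources_eweight_mul_apply_oddPart coe_oddPart_subset_traced_add ecurrentSum_empty_eq_ofReal
    sinh_pow_mul_cosh_pow_sub)

/-! ## §1 The four stub STATEMENTS (named `Prop`s, for reading; the registered `stub_*` theorems of
§2 restate them verbatim over tree declarations, `*_holds` certify the agreement definitionally, and
`Registered.stub_*` are the name-keyed aliases used as the hypotheses of `JoinForcesU4_of`). -/

section Statements

open scoped Classical

/-- STUB 1 statement — **the two-current odd-part law** (THE LEVER of the card): under the product
weight `1{∂n₁ = A} 1{∂n₂ = B} w_β(n₁) w_β(n₂)` the pair `(odd n₁, odd n₂)` is distributed as two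
INDEPENDENT sourced loop-O(1) configurations, for an ARBITRARY functional `g ≥ 0`:
`Σ w w g(odd n₁, odd n₂) = Σ_{∂F₁=A} sh^{|F₁|}ch^{|E|−|F₁|} Σ_{∂F₂=B} sh^{|F₂|}ch^{|E|−|F₂|} g(F₁,F₂)`
(the landed one-copy law `tsum_sources_eweight_mul_apply_oddPart` iterated once by Tonelli). -/
def PairOddPartLaw : Prop :=
  ∀ (V : Type) [Fintype V] [DecidableEq V] (G : SimpleGraph V) [DecidableRel G.Adj] (β : ℝ), 0 ≤ β →
    ∀ (A B : Finset V) (g : Finset (Sym2 V) → Finset (Sym2 V) → ℝ≥0∞),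
      ∑' p : Current G × Current G,
          epairWeight (fun _ : G.edgeFinset => β) A B p *
            g ((Finset.univ.filter fun e : G.edgeFinset => Odd (p.1 e)).map (Function.Embedding.subtype _))
              ((Finset.univ.filter fun e : G.edgeFinset => Odd (p.2 e)).map (Function.Embedding.subtype _)) =
        ∑ F₁ ∈ G.edgeFinset.powerset, if (∀ v, Odd (F₁.filter (v ∈ ·)).card ↔ v ∈ A) then
          ENNReal.ofReal (Real.sinh β ^ F₁.card * Real.cosh β ^ (G.edgeFinset.card - F₁.card)) *
            ∑ F₂ ∈ G.edgeFinset.powerset, (if (∀ v, Odd (F₂.filter (v ∈ ·)).card ↔ v ∈ B) then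
              ENNReal.ofReal (Real.sinh β ^ F₂.card * Real.cosh β ^ (G.edgeFinset.card - F₂.card)) *
                g F₁ F₂ else 0)
          else 0

/-- STUB 2 statement — **Aizenman's identity with odd-part domination, no switching**: in the additive
`ℝ≥0∞` product form `Z[01]Z[23] + Z[02]Z[13] + Z[03]Z[12] = Z[D]Z[∅] + 2P`
(`Current.ursellFour_currentSum_identity`, `P = Σ w w 1[a₂ ∈ C_{n₁+n₂}(a₀)]`) replace `P` by the smaller
sum over `1[a₀ ↔ a₂ in odd(n₁) ∪ odd(n₂)]` (`odd(nᵢ) ⊆ trace(n₁+n₂)`, landed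
`coe_oddPart_subset_traced_add`): `Z[D]Z[∅] + 2·OddJoin ≤ ΣZZ`. No injectivity, no law needed. -/
def AizenmanOddDomination : Prop :=
  ∀ (V : Type) [Fintype V] [DecidableEq V] (G : SimpleGraph V) [DecidableRel G.Adj] (β : ℝ), 0 ≤ β →
    ∀ a : Fin 4 → V,
      ecurrentSum (fun _ : G.edgeFinset => β) ({a 0} ∆ ({a 1} ∆ ({a 2} ∆ {a 3}))) *
            ecurrentSum (fun _ : G.edgeFinset => β) ∅ +
          2 * (∑' p : Current G × Current G,
            epairWeight (fun _ : G.edgeFinset => β) ({a 0} ∆ {a 1}) ({a 2} ∆ {a 3}) p *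
              (if (SimpleGraph.fromEdgeSet
                  ((↑((Finset.univ.filter fun e : G.edgeFinset => Odd (p.1 e)).map
                      (Function.Embedding.subtype _)) : Set (Sym2 V)) ∪
                    ↑((Finset.univ.filter fun e : G.edgeFinset => Odd (p.2 e)).map
                      (Function.Embedding.subtype _)))).Reachable (a 0) (a 2)
                then 1 else 0)) ≤
        ecurrentSum (fun _ : G.edgeFinset => β) ({a 0} ∆ {a 1}) *
            ecurrentSum (fun _ : G.edgeFinset => β) ({a 2} ∆ {a 3}) +
          ecurrentSum (fun _ : G.edgeFinset => β) ({a 0} ∆ {a 2}) *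
            ecurrentSum (fun _ : G.edgeFinset => β) ({a 1} ∆ {a 3}) +
          ecurrentSum (fun _ : G.edgeFinset => β) ({a 0} ∆ {a 3}) *
            ecurrentSum (fun _ : G.edgeFinset => β) ({a 1} ∆ {a 2})

/-- STUB 3 statement — **from the law and the domination to the route's support `StrandsJoinBound`
(item 14647)**: evaluate `OddJoin = cosh(β)^{2|E|}·J_{tanh β}` by the law with `g = 1[a₀ ↔ a₂ in F₁ ∪ F₂]`
(`sh^k ch^{|E|-k} = ch^{|E|} th^k` termwise), cast the `ℝ≥0∞` inequality to `ℝ`, read the free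
correlators as current-sum ratios and divide by `Z[∅]² = cosh^{2|E|}(Z⁰_t)²`. -/
def StrandsJoinOfLaw : Prop :=
  PairOddPartLaw → AizenmanOddDomination → StrandsJoinBound

/-- STUB 4 statement — the route's glue `LatticeBoundFromStrands` (item 14648) BY NAME:
K1 at `a = l•tetra ⊂ Λ_N` + the finite-graph bound on the induced box graph, transported to the free box
measure of `ℤ³` and passed to the limit `N → ∞` (`criticalCorr_wellDefined_holds`, continuity at `β_c(ℤ³)`). -/
def LatticeTransport : Prop :=
  LatticeBoundFromStrands

end Statements

/-! ## §2 The registered stubs — FILLED in this certificate (the skeleton has the bodies `by` + stub marker) -/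

section Stubs

open scoped Classical

/-! ### S1 — the pair law -/

/-- The odd part `odd(n) = {e ∈ E(G) : n_e odd}` of a current (proof-side abbreviation of the inlined
term of the statements). -/
abbrev oddPart {V : Type*} [Fintype V] {G : SimpleGraph V} [DecidableRel G.Adj] (n : Current G) :
    Finset (Sym2 V) :=
  (univ.filter fun e : G.edgeFinset => Odd (n e)).map (Function.Embedding.subtype _)

/-- **STUB 1 · `stub_pairOddPartLaw`** — the two-current odd-part law for an arbitrary functional
(= `PairOddPartLaw` verbatim). Size S–M. FILLED: Tonelli (`ENNReal.tsum_prod'`,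
`ENNReal.tsum_mul_left`, `epairWeight_eq_mul`) + the landed one-copy law twice. -/
theorem stub_pairOddPartLaw :
    ∀ (V : Type) [Fintype V] [DecidableEq V] (G : SimpleGraph V) [DecidableRel G.Adj] (β : ℝ), 0 ≤ β →
    ∀ (A B : Finset V) (g : Finset (Sym2 V) → Finset (Sym2 V) → ℝ≥0∞),
      ∑' p : Current G × Current G,
          epairWeight (fun _ : G.edgeFinset => β) A B p *
            g ((Finset.univ.filter fun e : G.edgeFinset => Odd (p.1 e)).map (Function.Embedding.subtype _))
              ((Finset.univ.filter fun e : G.edgeFinset => Odd (p.2 e)).map (Function.Embedding.subtype _)) =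
        ∑ F₁ ∈ G.edgeFinset.powerset, if (∀ v, Odd (F₁.filter (v ∈ ·)).card ↔ v ∈ A) then
          ENNReal.ofReal (Real.sinh β ^ F₁.card * Real.cosh β ^ (G.edgeFinset.card - F₁.card)) *
            ∑ F₂ ∈ G.edgeFinset.powerset, (if (∀ v, Odd (F₂.filter (v ∈ ·)).card ↔ v ∈ B) then
              ENNReal.ofReal (Real.sinh β ^ F₂.card * Real.cosh β ^ (G.edgeFinset.card - F₂.card)) *
                g F₁ F₂ else 0)
          else 0 := by
  intro V _ _ G _ β hβ A B g
  have inner : ∀ F₁ : Finset (Sym2 V),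
      ∑' n₂ : Current G, (if n₂.sources = B then n₂.eweight (fun _ : G.edgeFinset => β) else 0) *
          g F₁ (oddPart n₂) =
        ∑ F₂ ∈ G.edgeFinset.powerset, (if (∀ v, Odd #(F₂.filter (v ∈ ·)) ↔ v ∈ B) then
            ENNReal.ofReal (Real.sinh β ^ #F₂ * Real.cosh β ^ (#G.edgeFinset - #F₂)) * g F₁ F₂ else 0) :=
    fun F₁ => tsum_sources_eweight_mul_apply_oddPart hβ B (g F₁)
  calc ∑' p : Current G × Current G,
        epairWeight (fun _ : G.edgeFinset => β) A B p * g (oddPart p.1) (oddPart p.2)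
      = ∑' (n₁ : Current G) (n₂ : Current G),
          (if n₁.sources = A then n₁.eweight (fun _ : G.edgeFinset => β) else 0) *
            ((if n₂.sources = B then n₂.eweight (fun _ : G.edgeFinset => β) else 0) *
              g (oddPart n₁) (oddPart n₂)) := by
        rw [ENNReal.tsum_prod']
        refine tsum_congr fun n₁ => tsum_congr fun n₂ => ?_
        rw [epairWeight_eq_mul, mul_assoc]
    _ = ∑' n₁ : Current G, (if n₁.sources = A then n₁.eweight (fun _ : G.edgeFinset => β) else 0) *
          ∑ F₂ ∈ G.edgeFinset.powerset, (if (∀ v, Odd #(F₂.filter (v ∈ ·)) ↔ v ∈ B) then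
            ENNReal.ofReal (Real.sinh β ^ #F₂ * Real.cosh β ^ (#G.edgeFinset - #F₂)) *
              g (oddPart n₁) F₂ else 0) := by
        refine tsum_congr fun n₁ => ?_
        rw [ENNReal.tsum_mul_left, inner]
    _ = _ := tsum_sources_eweight_mul_apply_oddPart hβ A (fun F₁ =>
          ∑ F₂ ∈ G.edgeFinset.powerset, (if (∀ v, Odd #(F₂.filter (v ∈ ·)) ↔ v ∈ B) then
            ENNReal.ofReal (Real.sinh β ^ #F₂ * Real.cosh β ^ (#G.edgeFinset - #F₂)) * g F₁ F₂ else 0))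

/-! ### S2 — Aizenman's identity + odd-part domination -/

/-- `odd(n₁) ∪ odd(n₂) ⊆ trace(n₁ + n₂)`, so joining in the odd parts implies joining in the double
current (from the landed `coe_oddPart_subset_traced_add`). [CandidateProof, ideator 2] -/
theorem ite_reachable_oddPart_le {V : Type*} [Fintype V] [DecidableEq V] {G : SimpleGraph V}
    [DecidableRel G.Adj] (a : Fin 4 → V) (p : Current G × Current G) :
    (if (SimpleGraph.fromEdgeSet
          ((↑((univ.filter fun e : G.edgeFinset => Odd (p.1 e)).map
              (Function.Embedding.subtype _)) : Set (Sym2 V)) ∪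
            ↑((univ.filter fun e : G.edgeFinset => Odd (p.2 e)).map
              (Function.Embedding.subtype _)))).Reachable (a 0) (a 2)
        then (1 : ℝ≥0∞) else 0) ≤
      (if a 2 ∈ (p.1 + p.2).cluster (a 0) then 1 else 0) := by
  by_cases h : (SimpleGraph.fromEdgeSet
          ((↑((univ.filter fun e : G.edgeFinset => Odd (p.1 e)).map
              (Function.Embedding.subtype _)) : Set (Sym2 V)) ∪
            ↑((univ.filter fun e : G.edgeFinset => Odd (p.2 e)).map
              (Function.Embedding.subtype _)))).Reachable (a 0) (a 2)
  · have h2 : (↑((univ.filter fun e : G.edgeFinset => Odd (p.2 e)).map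
        (Function.Embedding.subtype _)) : Set (Sym2 V)) ⊆ (p.1 + p.2).traced := by
      rw [add_comm]
      exact coe_oddPart_subset_traced_add p.2 p.1
    have hle : SimpleGraph.fromEdgeSet
          ((↑((univ.filter fun e : G.edgeFinset => Odd (p.1 e)).map
              (Function.Embedding.subtype _)) : Set (Sym2 V)) ∪
            ↑((univ.filter fun e : G.edgeFinset => Odd (p.2 e)).map
              (Function.Embedding.subtype _))) ≤
        Literature.Probability.Percolation.openGraph (p.1 + p.2).traced :=
      SimpleGraph.fromEdgeSet_mono (Set.union_subset (coe_oddPart_subset_traced_add p.1 p.2) h2)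
    rw [if_pos h, if_pos (Current.mem_cluster_iff.2 (h.mono hle))]
  · rw [if_neg h]
    exact bot_le

/-- **STUB 2 · `stub_aizenmanOddDomination`** — `Z[D]Z[∅] + 2·OddJoin ≤ ΣZZ` in `ℝ≥0∞`
(= `AizenmanOddDomination` verbatim). Size S. FILLED: rewrite the right side by
`Current.ursellFour_currentSum_identity` and compare the two `tsum`s termwise. -/
theorem stub_aizenmanOddDomination :
    ∀ (V : Type) [Fintype V] [DecidableEq V] (G : SimpleGraph V) [DecidableRel G.Adj] (β : ℝ), 0 ≤ β →
    ∀ a : Fin 4 → V,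
      ecurrentSum (fun _ : G.edgeFinset => β) ({a 0} ∆ ({a 1} ∆ ({a 2} ∆ {a 3}))) *
            ecurrentSum (fun _ : G.edgeFinset => β) ∅ +
          2 * (∑' p : Current G × Current G,
            epairWeight (fun _ : G.edgeFinset => β) ({a 0} ∆ {a 1}) ({a 2} ∆ {a 3}) p *
              (if (SimpleGraph.fromEdgeSet
                  ((↑((Finset.univ.filter fun e : G.edgeFinset => Odd (p.1 e)).map
                      (Function.Embedding.subtype _)) : Set (Sym2 V)) ∪
                    ↑((Finset.univ.filter fun e : G.edgeFinset => Odd (p.2 e)).map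
                      (Function.Embedding.subtype _)))).Reachable (a 0) (a 2)
                then 1 else 0)) ≤
        ecurrentSum (fun _ : G.edgeFinset => β) ({a 0} ∆ {a 1}) *
            ecurrentSum (fun _ : G.edgeFinset => β) ({a 2} ∆ {a 3}) +
          ecurrentSum (fun _ : G.edgeFinset => β) ({a 0} ∆ {a 2}) *
            ecurrentSum (fun _ : G.edgeFinset => β) ({a 1} ∆ {a 3}) +
          ecurrentSum (fun _ : G.edgeFinset => β) ({a 0} ∆ {a 3}) *
            ecurrentSum (fun _ : G.edgeFinset => β) ({a 1} ∆ {a 2}) := by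
  intro V _ _ G _ β hβ a
  rw [Current.ursellFour_currentSum_identity (K := fun _ : G.edgeFinset => β) (fun _ => hβ)
    (a 0) (a 1) (a 2) (a 3)]
  exact add_le_add le_rfl (mul_le_mul' le_rfl
    (ENNReal.tsum_le_tsum fun p => mul_le_mul' le_rfl (ite_reachable_oddPart_le a p)))

/-! ### S3 — evaluation, cast to `ℝ`, correlator dictionary -/

/-- The joint loop-O(1) sum `J_t(a)` of the crux (proof-side abbreviation; verbatim the double sum of
`IndependentStrandsJoin` / `StrandsJoinBound`). -/
def jointSum {V : Type*} [Fintype V] [DecidableEq V] (G : SimpleGraph V) [DecidableRel G.Adj]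
    (t : ℝ) (a : Fin 4 → V) : ℝ :=
  ∑ F₁ ∈ tJoins G Set.univ {a 0, a 1}, ∑ F₂ ∈ tJoins G Set.univ {a 2, a 3},
    if (SimpleGraph.fromEdgeSet ((↑F₁ : Set (Sym2 V)) ∪ ↑F₂)).Reachable (a 0) (a 2)
      then t ^ (#F₁ + #F₂) else 0

/-- `tJoins G univ A` is the powerset filtered by the source condition alone. [CandidateProof] -/
theorem tJoins_univ_eq_filter {V : Type*} [Fintype V] [DecidableEq V] (G : SimpleGraph V)
    [DecidableRel G.Adj] (A : Finset V) :
    tJoins G Set.univ A =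
      G.edgeFinset.powerset.filter (fun F => ∀ v, Odd #(F.filter (v ∈ ·)) ↔ v ∈ A) := by
  unfold tJoins
  exact Finset.filter_congr fun F _ => by simp only [Set.subset_univ, true_and]

/-- EVALUATION: the law with `g = 1[a₀ ↔ a₂ in F₁ ∪ F₂]` turns `OddJoin` into
`cosh(β)^{2|E|} · J_{tanh β}(a)` (step 4 of `twoCopyPushforward_holds`, CandidateProof). -/
theorem oddJoin_eq_of_law (hLaw : PairOddPartLaw) {V : Type} [Fintype V] [DecidableEq V]
    (G : SimpleGraph V) [DecidableRel G.Adj] {β : ℝ} (hβ : 0 ≤ β) (a : Fin 4 → V)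
    (ha : Function.Injective a) :
    (∑' p : Current G × Current G,
        epairWeight (fun _ : G.edgeFinset => β) ({a 0} ∆ {a 1}) ({a 2} ∆ {a 3}) p *
          (if (SimpleGraph.fromEdgeSet
              ((↑((Finset.univ.filter fun e : G.edgeFinset => Odd (p.1 e)).map
                  (Function.Embedding.subtype _)) : Set (Sym2 V)) ∪
                ↑((Finset.univ.filter fun e : G.edgeFinset => Odd (p.2 e)).map
                  (Function.Embedding.subtype _)))).Reachable (a 0) (a 2)
            then 1 else 0)) =
      ENNReal.ofReal (Real.cosh β ^ (2 * #G.edgeFinset) * jointSum G (Real.tanh β) a) := by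
  -- notation
  set gI : Finset (Sym2 V) → Finset (Sym2 V) → ℝ≥0∞ := fun F₁ F₂ =>
    if (SimpleGraph.fromEdgeSet ((↑F₁ : Set (Sym2 V)) ∪ ↑F₂)).Reachable (a 0) (a 2) then 1 else 0
    with hgI
  set oddP : Current G → Finset (Sym2 V) := fun n =>
    (univ.filter fun e : G.edgeFinset => Odd (n e)).map (Function.Embedding.subtype _) with hoddP
  set sc : Finset (Sym2 V) → ℝ≥0∞ := fun F =>
    ENNReal.ofReal (Real.sinh β ^ #F * Real.cosh β ^ (#G.edgeFinset - #F)) with hsc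
  have h01 : ({a 0} : Finset V) ∆ {a 1} = {a 0, a 1} :=
    Current.symmDiff_singleton_eq_pair (ha.ne (by decide))
  have h23 : ({a 2} : Finset V) ∆ {a 3} = {a 2, a 3} :=
    Current.symmDiff_singleton_eq_pair (ha.ne (by decide))
  rw [h01, h23]
  set H : Finset (Sym2 V) → ℝ≥0∞ := fun F₁ =>
    ∑ F₂ ∈ G.edgeFinset.powerset,
      if (∀ v, Odd #(F₂.filter (v ∈ ·)) ↔ v ∈ ({a 2, a 3} : Finset V)) then sc F₂ * gI F₁ F₂ else 0
    with hH
  -- the law, instantiated (steps 1–3 of the same-file template in ONE application)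
  have lhs_eq : (∑' p : Current G × Current G,
        epairWeight (fun _ : G.edgeFinset => β) {a 0, a 1} {a 2, a 3} p * gI (oddP p.1) (oddP p.2)) =
      ∑ F₁ ∈ G.edgeFinset.powerset,
        if (∀ v, Odd #(F₁.filter (v ∈ ·)) ↔ v ∈ ({a 0, a 1} : Finset V)) then sc F₁ * H F₁ else 0 :=
    hLaw V G β hβ {a 0, a 1} {a 2, a 3} gI
  show (∑' p : Current G × Current G,
        epairWeight (fun _ : G.edgeFinset => β) {a 0, a 1} {a 2, a 3} p * gI (oddP p.1) (oddP p.2)) = _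
  rw [lhs_eq]
  -- identify the finite double sum with `cosh^{2|E|} · jointSum`
  rw [← Finset.sum_filter, ← tJoins_univ_eq_filter G {a 0, a 1}]
  have hH' : ∀ F₁, H F₁ = ∑ F₂ ∈ tJoins G Set.univ {a 2, a 3}, sc F₂ * gI F₁ F₂ := by
    intro F₁
    rw [hH, tJoins_univ_eq_filter G {a 2, a 3}, Finset.sum_filter]
  simp_rw [hH']
  have ht : 0 ≤ Real.tanh β := by
    rw [Real.tanh_eq_sinh_div_cosh]
    exact div_nonneg (Real.sinh_nonneg_iff.2 hβ) (Real.cosh_pos β).le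
  have hterm_nonneg : ∀ F₁ F₂ : Finset (Sym2 V), 0 ≤ Real.cosh β ^ (2 * #G.edgeFinset) *
      (if (SimpleGraph.fromEdgeSet ((↑F₁ : Set (Sym2 V)) ∪ ↑F₂)).Reachable (a 0) (a 2)
        then Real.tanh β ^ (#F₁ + #F₂) else 0) := by
    intro F₁ F₂
    refine mul_nonneg (pow_nonneg (Real.cosh_pos β).le _) ?_
    split_ifs
    · exact pow_nonneg ht _
    · exact le_rfl
  have hR : ENNReal.ofReal (Real.cosh β ^ (2 * #G.edgeFinset) * jointSum G (Real.tanh β) a) =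
      ∑ F₁ ∈ tJoins G Set.univ {a 0, a 1}, ∑ F₂ ∈ tJoins G Set.univ {a 2, a 3},
        ENNReal.ofReal (Real.cosh β ^ (2 * #G.edgeFinset) *
          (if (SimpleGraph.fromEdgeSet ((↑F₁ : Set (Sym2 V)) ∪ ↑F₂)).Reachable (a 0) (a 2)
            then Real.tanh β ^ (#F₁ + #F₂) else 0)) := by
    rw [jointSum, Finset.mul_sum]
    rw [ENNReal.ofReal_sum_of_nonneg (fun F₁ _ => by
      rw [Finset.mul_sum]; exact Finset.sum_nonneg fun F₂ _ => hterm_nonneg F₁ F₂)]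
    refine Finset.sum_congr rfl fun F₁ _ => ?_
    rw [Finset.mul_sum, ENNReal.ofReal_sum_of_nonneg (fun F₂ _ => hterm_nonneg F₁ F₂)]
  rw [hR]
  refine Finset.sum_congr rfl fun F₁ hF₁ => ?_
  rw [Finset.mul_sum]
  refine Finset.sum_congr rfl fun F₂ hF₂ => ?_
  have hk₁ : #F₁ ≤ #G.edgeFinset := Finset.card_le_card ((mem_tJoins G).1 hF₁).1
  have hk₂ : #F₂ ≤ #G.edgeFinset := Finset.card_le_card ((mem_tJoins G).1 hF₂).1
  simp only [hsc, hgI]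
  rw [sinh_pow_mul_cosh_pow_sub β hk₁, sinh_pow_mul_cosh_pow_sub β hk₂]
  have hc : 0 ≤ Real.cosh β ^ #G.edgeFinset := pow_nonneg (Real.cosh_pos β).le _
  by_cases hRch : (SimpleGraph.fromEdgeSet ((↑F₁ : Set (Sym2 V)) ∪ ↑F₂)).Reachable (a 0) (a 2)
  · rw [if_pos hRch, if_pos hRch, mul_one,
      ← ENNReal.ofReal_mul (mul_nonneg hc (pow_nonneg ht _))]
    congr 1
    ring
  · rw [if_neg hRch, if_neg hRch, mul_zero, mul_zero, mul_zero, ENNReal.ofReal_zero]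

/-- The two-copy bound in `ℝ≥0∞`, evaluated: `Z[D]Z[∅] + 2·cosh^{2|E|}·J ≤ ΣZZ`
(from the two stub statements; = CandidateProof's `TwoCopyOddPartBound` instance). -/
theorem twoCopyBound_of (hLaw : PairOddPartLaw) (hDom : AizenmanOddDomination) {V : Type} [Fintype V]
    [DecidableEq V] (G : SimpleGraph V) [DecidableRel G.Adj] {β : ℝ} (hβ : 0 ≤ β) (a : Fin 4 → V)
    (ha : Function.Injective a) :
    ecurrentSum (fun _ : G.edgeFinset => β) ({a 0} ∆ ({a 1} ∆ ({a 2} ∆ {a 3}))) *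
          ecurrentSum (fun _ : G.edgeFinset => β) ∅ +
        2 * ENNReal.ofReal (Real.cosh β ^ (2 * #G.edgeFinset) * jointSum G (Real.tanh β) a) ≤
      ecurrentSum (fun _ : G.edgeFinset => β) ({a 0} ∆ {a 1}) *
          ecurrentSum (fun _ : G.edgeFinset => β) ({a 2} ∆ {a 3}) +
        ecurrentSum (fun _ : G.edgeFinset => β) ({a 0} ∆ {a 2}) *
          ecurrentSum (fun _ : G.edgeFinset => β) ({a 1} ∆ {a 3}) +
        ecurrentSum (fun _ : G.edgeFinset => β) ({a 0} ∆ {a 3}) *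
          ecurrentSum (fun _ : G.edgeFinset => β) ({a 1} ∆ {a 2}) := by
  have h := hDom V G β hβ a
  rw [oddJoin_eq_of_law hLaw G hβ a ha] at h
  exact h

/-- The sourceless loop-O(1) partition function is the sum over even subgraphs. [CandidateProof] -/
theorem loopO1PartitionFunction_empty_eq {V : Type*} [Fintype V] [DecidableEq V] (G : SimpleGraph V)
    [DecidableRel G.Adj] (t : ℝ) :
    loopO1PartitionFunction G t ∅ = ∑ F ∈ evenSubgraphs G Set.univ, t ^ #F := by
  unfold loopO1PartitionFunction loopO1Weight evenSubgraphs
  rw [← Finset.sum_filter]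
  congr 1
  rw [Finset.filter_mem_eq_inter, Finset.inter_eq_right]
  intro F hF
  exact Finset.mem_powerset.2 ((mem_tJoins G).1 hF).1

/-- CAST + DICTIONARY: from the evaluated `ℝ≥0∞` bound to the route's `StrandsJoinBound`
(= `strandsJoinBoundShape_holds` of CandidateProof with the input abstracted). -/
theorem strandsJoinBound_of_twoCopy (hLaw : PairOddPartLaw) (hDom : AizenmanOddDomination) :
    StrandsJoinBound := by
  intro V _ _ G _ β hβ a ha
  set K : G.edgeFinset → ℝ := fun _ => β with hKdef
  have hK : ∀ e : G.edgeFinset, 0 ≤ K e := fun _ => hβ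
  set z : Finset V → ℝ := fun A => wcurrentSum K A with hz
  set D : Finset V := {a 0} ∆ ({a 1} ∆ ({a 2} ∆ {a 3})) with hD
  set cE : ℝ := Real.cosh β ^ #G.edgeFinset with hcE
  set Z0 : ℝ := loopO1PartitionFunction G (Real.tanh β) ∅ with hZ0
  set J : ℝ := jointSum G (Real.tanh β) a with hJ
  have ht : 0 ≤ Real.tanh β := by
    rw [Real.tanh_eq_sinh_div_cosh]
    exact div_nonneg (Real.sinh_nonneg_iff.2 hβ) (Real.cosh_pos β).le
  have hcE0 : 0 < cE := pow_pos (Real.cosh_pos β) _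
  have hZ00 : 0 < Z0 := loopO1PartitionFunction_empty_pos G ht
  have hJ0 : 0 ≤ J := by
    refine Finset.sum_nonneg fun F₁ _ => Finset.sum_nonneg fun F₂ _ => ?_
    split_ifs
    · exact pow_nonneg ht _
    · exact le_rfl
  have hz_nonneg : ∀ A, 0 ≤ z A := fun A => wcurrentSum_nonneg hK A
  have hc2 : Real.cosh β ^ (2 * #G.edgeFinset) = cE ^ 2 := by rw [hcE, ← pow_mul']
  -- `Z[∅] = cosh^{|E|} · Z⁰_t`
  have hz0 : z ∅ = cE * Z0 := by
    have h := ecurrentSum_empty_eq_ofReal (G := G) hβ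
    rw [ecurrentSum_eq_ofReal hK] at h
    have h' := congrArg ENNReal.toReal h
    rwa [ENNReal.toReal_ofReal (hz_nonneg ∅), ENNReal.toReal_ofReal
      (mul_nonneg hcE0.le (Finset.sum_nonneg fun F _ => pow_nonneg ht _)),
      ← loopO1PartitionFunction_empty_eq] at h'
  -- the two-copy bound, cast to `ℝ`
  have h1b := twoCopyBound_of hLaw hDom G hβ a ha
  have eL : ecurrentSum K D * ecurrentSum K ∅ + 2 * ENNReal.ofReal (Real.cosh β ^ (2 * #G.edgeFinset) * J) =
      ENNReal.ofReal (z D * z ∅ + 2 * (cE ^ 2 * J)) := by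
    have h2J : (0:ℝ) ≤ 2 * (cE ^ 2 * J) := mul_nonneg (by norm_num) (mul_nonneg (sq_nonneg _) hJ0)
    rw [ENNReal.ofReal_add (mul_nonneg (hz_nonneg D) (hz_nonneg ∅)) h2J,
      ENNReal.ofReal_mul (hz_nonneg D), ENNReal.ofReal_mul (by norm_num : (0:ℝ) ≤ 2),
      ENNReal.ofReal_ofNat, ecurrentSum_eq_ofReal hK, ecurrentSum_eq_ofReal hK, hc2]
  have eR : ecurrentSum K ({a 0} ∆ {a 1}) * ecurrentSum K ({a 2} ∆ {a 3}) +
        ecurrentSum K ({a 0} ∆ {a 2}) * ecurrentSum K ({a 1} ∆ {a 3}) +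
        ecurrentSum K ({a 0} ∆ {a 3}) * ecurrentSum K ({a 1} ∆ {a 2}) =
      ENNReal.ofReal (z ({a 0} ∆ {a 1}) * z ({a 2} ∆ {a 3}) + z ({a 0} ∆ {a 2}) * z ({a 1} ∆ {a 3}) +
        z ({a 0} ∆ {a 3}) * z ({a 1} ∆ {a 2})) := by
    have hp : ∀ A B : Finset V, 0 ≤ z A * z B := fun A B => mul_nonneg (hz_nonneg A) (hz_nonneg B)
    rw [ENNReal.ofReal_add (add_nonneg (hp _ _) (hp _ _)) (hp _ _), ENNReal.ofReal_add (hp _ _) (hp _ _),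
      ENNReal.ofReal_mul (hz_nonneg _), ENNReal.ofReal_mul (hz_nonneg _), ENNReal.ofReal_mul (hz_nonneg _)]
    simp only [hz, ecurrentSum_eq_ofReal hK]
  have h1bR : z D * z ∅ + 2 * (cE ^ 2 * J) ≤
      z ({a 0} ∆ {a 1}) * z ({a 2} ∆ {a 3}) + z ({a 0} ∆ {a 2}) * z ({a 1} ∆ {a 3}) +
        z ({a 0} ∆ {a 3}) * z ({a 1} ∆ {a 2}) := by
    have hp : ∀ A B : Finset V, 0 ≤ z A * z B := fun A B => mul_nonneg (hz_nonneg A) (hz_nonneg B)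
    have h := h1b
    rw [eL, eR, ENNReal.ofReal_le_ofReal_iff (add_nonneg (add_nonneg (hp _ _) (hp _ _)) (hp _ _))] at h
    exact h
  -- the correlators as current-sum ratios
  have h4 : nPoint (isingMeasure G Finset.univ β 0 .free) spinAt a = z D / z ∅ := by
    have hmono : spinMonomial a = spinMonomial ![a 0, a 1, a 2, a 3] := by
      congr 1; funext i; fin_cases i <;> rfl
    rw [nPoint_isingMeasure, hmono, isingExpect_spinMonomial_four_eq G β (a 0) (a 1) (a 2) (a 3)]
    rfl
  have h2 : ∀ x y : V, twoPoint (isingMeasure G Finset.univ β 0 .free) spinAt x y = z ({x} ∆ {y}) / z ∅ := by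
    intro x y
    rw [twoPoint_isingMeasure, isingTwoPoint_free_eq_currentSum_div_holds G β x y]
    rfl
  show connectedFour (isingMeasure G Finset.univ β 0 .free) spinAt a * Z0 ^ 2 ≤ -(2 * J)
  unfold connectedFour
  simp only [h4, h2, hz0]
  rw [hz0] at h1bR
  have key : (z D / (cE * Z0) - z ({a 0} ∆ {a 1}) / (cE * Z0) * (z ({a 2} ∆ {a 3}) / (cE * Z0)) -
        z ({a 0} ∆ {a 2}) / (cE * Z0) * (z ({a 1} ∆ {a 3}) / (cE * Z0)) -
        z ({a 0} ∆ {a 3}) / (cE * Z0) * (z ({a 1} ∆ {a 2}) / (cE * Z0))) * Z0 ^ 2 =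
      (z D * (cE * Z0) - (z ({a 0} ∆ {a 1}) * z ({a 2} ∆ {a 3}) + z ({a 0} ∆ {a 2}) * z ({a 1} ∆ {a 3}) +
        z ({a 0} ∆ {a 3}) * z ({a 1} ∆ {a 2}))) / cE ^ 2 := by
    field_simp
    ring
  rw [key, div_le_iff₀ (by positivity)]
  nlinarith [h1bR]

/-- **STUB 3 · `stub_strandsJoinBound_of`** — law + domination ⇒ `StrandsJoinBound` (item 14647)
(= `StrandsJoinOfLaw` with both hypotheses expanded). Size M. FILLED: `strandsJoinBound_of_twoCopy`. -/
theorem stub_strandsJoinBound_of :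
    (∀ (V : Type) [Fintype V] [DecidableEq V] (G : SimpleGraph V) [DecidableRel G.Adj] (β : ℝ), 0 ≤ β →
      ∀ (A B : Finset V) (g : Finset (Sym2 V) → Finset (Sym2 V) → ℝ≥0∞),
        ∑' p : Current G × Current G,
            epairWeight (fun _ : G.edgeFinset => β) A B p *
              g ((Finset.univ.filter fun e : G.edgeFinset => Odd (p.1 e)).map (Function.Embedding.subtype _))
                ((Finset.univ.filter fun e : G.edgeFinset => Odd (p.2 e)).map (Function.Embedding.subtype _)) =
          ∑ F₁ ∈ G.edgeFinset.powerset, if (∀ v, Odd (F₁.filter (v ∈ ·)).card ↔ v ∈ A) then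
            ENNReal.ofReal (Real.sinh β ^ F₁.card * Real.cosh β ^ (G.edgeFinset.card - F₁.card)) *
              ∑ F₂ ∈ G.edgeFinset.powerset, (if (∀ v, Odd (F₂.filter (v ∈ ·)).card ↔ v ∈ B) then
                ENNReal.ofReal (Real.sinh β ^ F₂.card * Real.cosh β ^ (G.edgeFinset.card - F₂.card)) *
                  g F₁ F₂ else 0)
            else 0) →
    (∀ (V : Type) [Fintype V] [DecidableEq V] (G : SimpleGraph V) [DecidableRel G.Adj] (β : ℝ), 0 ≤ β →
      ∀ a : Fin 4 → V,
        ecurrentSum (fun _ : G.edgeFinset => β) ({a 0} ∆ ({a 1} ∆ ({a 2} ∆ {a 3}))) *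
              ecurrentSum (fun _ : G.edgeFinset => β) ∅ +
            2 * (∑' p : Current G × Current G,
              epairWeight (fun _ : G.edgeFinset => β) ({a 0} ∆ {a 1}) ({a 2} ∆ {a 3}) p *
                (if (SimpleGraph.fromEdgeSet
                    ((↑((Finset.univ.filter fun e : G.edgeFinset => Odd (p.1 e)).map
                        (Function.Embedding.subtype _)) : Set (Sym2 V)) ∪
                      ↑((Finset.univ.filter fun e : G.edgeFinset => Odd (p.2 e)).map
                        (Function.Embedding.subtype _)))).Reachable (a 0) (a 2)
                  then 1 else 0)) ≤
          ecurrentSum (fun _ : G.edgeFinset => β) ({a 0} ∆ {a 1}) *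
              ecurrentSum (fun _ : G.edgeFinset => β) ({a 2} ∆ {a 3}) +
            ecurrentSum (fun _ : G.edgeFinset => β) ({a 0} ∆ {a 2}) *
              ecurrentSum (fun _ : G.edgeFinset => β) ({a 1} ∆ {a 3}) +
            ecurrentSum (fun _ : G.edgeFinset => β) ({a 0} ∆ {a 3}) *
              ecurrentSum (fun _ : G.edgeFinset => β) ({a 1} ∆ {a 2})) →
    StrandsJoinBound :=
  fun hLaw hDom => strandsJoinBound_of_twoCopy hLaw hDom

/-! ### S4 — the lattice transport (route glue `LatticeBoundFromStrands`, item 14648) -/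

/-- `Z_β[A] = cosh(β)^{|E|} · Z^A_{tanh β}` for every source set `A` (one-copy law with `g ≡ 1`).
[CandidateProof] -/
theorem ecurrentSum_eq_ofReal_loopO1 {V : Type*} [Fintype V] [DecidableEq V] {G : SimpleGraph V}
    [DecidableRel G.Adj] {β : ℝ} (hβ : 0 ≤ β) (A : Finset V) :
    ecurrentSum (fun _ : G.edgeFinset => β) A =
      ENNReal.ofReal (Real.cosh β ^ #G.edgeFinset * loopO1PartitionFunction G (Real.tanh β) A) := by
  have ht : 0 ≤ Real.tanh β := by
    rw [Real.tanh_eq_sinh_div_cosh]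
    exact div_nonneg (Real.sinh_nonneg_iff.2 hβ) (Real.cosh_pos β).le
  have h := tsum_sources_eweight_mul_apply_oddPart (G := G) hβ A (fun _ => 1)
  simp only [mul_one] at h
  unfold ecurrentSum
  rw [h]
  unfold loopO1PartitionFunction loopO1Weight
  rw [Finset.mul_sum, ENNReal.ofReal_sum_of_nonneg (fun F _ => by
    split_ifs
    · exact mul_nonneg (pow_nonneg (Real.cosh_pos β).le _) (pow_nonneg ht _)
    · rw [mul_zero])]
  refine Finset.sum_congr rfl fun F hF => ?_
  have hle : #F ≤ #G.edgeFinset := Finset.card_le_card (Finset.mem_powerset.1 hF)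
  by_cases hc : (∀ v, Odd #(F.filter (v ∈ ·)) ↔ v ∈ A)
  · have hc' : F ∈ tJoins G Set.univ A :=
      (mem_tJoins G).2 ⟨Finset.mem_powerset.1 hF, Set.subset_univ _, hc⟩
    rw [if_pos hc, if_pos hc', sinh_pow_mul_cosh_pow_sub β hle]
  · have hc' : F ∉ tJoins G Set.univ A := fun h => hc ((mem_tJoins G).1 h).2.2
    rw [if_neg hc, if_neg hc', mul_zero, ENNReal.ofReal_zero]

/-- Free two-point function as a ratio of loop-O(1) partition functions, `⟨σ_xσ_y⟩ = Z^{xy}_t / Z^∅_t`,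
`t = tanh β`, `x ≠ y`. [CandidateProof] -/
theorem twoPoint_eq_loopO1_div {V : Type*} [Fintype V] [DecidableEq V] {G : SimpleGraph V}
    [DecidableRel G.Adj] {β : ℝ} (hβ : 0 ≤ β) {x y : V} (hxy : x ≠ y) :
    twoPoint (isingMeasure G Finset.univ β 0 .free) spinAt x y =
      loopO1PartitionFunction G (Real.tanh β) {x, y} / loopO1PartitionFunction G (Real.tanh β) ∅ := by
  have ht : 0 ≤ Real.tanh β := by
    rw [Real.tanh_eq_sinh_div_cosh]
    exact div_nonneg (Real.sinh_nonneg_iff.2 hβ) (Real.cosh_pos β).le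
  have hK : ∀ _e : G.edgeFinset, 0 ≤ β := fun _ => hβ
  have hcE : 0 < Real.cosh β ^ #G.edgeFinset := pow_pos (Real.cosh_pos β) _
  have hz : ∀ A : Finset V, wcurrentSum (fun _ : G.edgeFinset => β) A =
      Real.cosh β ^ #G.edgeFinset * loopO1PartitionFunction G (Real.tanh β) A := by
    intro A
    rw [← toReal_ecurrentSum hK, ecurrentSum_eq_ofReal_loopO1 hβ A, ENNReal.toReal_ofReal
      (mul_nonneg hcE.le (loopO1PartitionFunction_nonneg G ht A))]
  rw [twoPoint_isingMeasure, isingTwoPoint_free_eq_currentSum_div_holds G β x y,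
    Current.symmDiff_singleton_eq_pair hxy, currentSum_eq_wcurrentSum, currentSum_eq_wcurrentSum, hz, hz,
    mul_div_mul_left _ _ hcE.ne']

/-- The two-point monomial is the two-point function. [folklore] -/
theorem isingExpect_spinMonomial_two {V : Type*} [DecidableEq V] (G : SimpleGraph V) [DecidableRel G.Adj]
    [G.LocallyFinite] (Λ : Finset V) (β : ℝ) (x y : V) :
    isingExpect G Λ β 0 .free (spinMonomial ![x, y]) = twoPoint (isingMeasure G Λ β 0 .free) spinAt x y := by
  rw [← nPoint_isingMeasure]
  simp only [nPoint, twoPoint, Fin.prod_univ_two, Matrix.cons_val_zero, Matrix.cons_val_one]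

end Stubs

section Transport

/-- TRANSPORT of `n`-point functions: the free Ising measure of the graph INDUCED on `Λ ⊂ ℤ^d` has the
spin moments of the free finite-volume measure `⟨·⟩^∅_Λ` of `ℤ^d` (`isingExpect_free_map` with
`φ = Subtype.val`). [CandidateProof] -/
theorem nPoint_boxComap {d : ℕ} (Λ : Finset (Site d)) (β : ℝ) {m : ℕ} (y : Fin m → ↥Λ) :
    nPoint (isingMeasure ((zdGraph d).comap (Subtype.val : ↥Λ → Site d)) univ β 0 .free) spinAt y =
      nPoint (isingMeasure (zdGraph d) Λ β 0 .free) spinAt (fun i => (y i : Site d)) := by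
  classical
  set ι : ↥Λ ↪ Site d := Function.Embedding.subtype (· ∈ Λ) with hι
  have hmap : (univ : Finset ↥Λ).map ι = Λ := by
    rw [hι, Finset.univ_eq_attach, Finset.attach_map_val]
  have hadj : ∀ a ∈ (univ : Finset ↥Λ), ∀ b ∈ (univ : Finset ↥Λ),
      ((zdGraph d).Adj (ι a) (ι b) ↔ ((zdGraph d).comap (Subtype.val : ↥Λ → Site d)).Adj a b) :=
    fun _ _ _ _ => Iff.rfl
  have key := isingExpect_free_map (G := (zdGraph d).comap (Subtype.val : ↥Λ → Site d))
    (G' := zdGraph d) ι (Λ := univ) hadj β 0 (measurable_spinMonomial fun i => (y i : Site d))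
  rw [hmap] at key
  change isingExpect _ univ β 0 .free (spinMonomial y) =
    isingExpect (zdGraph d) Λ β 0 .free (spinMonomial fun i => (y i : Site d))
  rw [key]
  congr 1
  funext σ
  simp only [spinMonomial]
  exact Finset.prod_congr rfl fun i _ => (spinAt_extendAlong ι σ (y i)).symm

theorem twoPoint_boxComap {d : ℕ} (Λ : Finset (Site d)) (β : ℝ) (a b : ↥Λ) :
    twoPoint (isingMeasure ((zdGraph d).comap (Subtype.val : ↥Λ → Site d)) univ β 0 .free) spinAt a b =
      twoPoint (isingMeasure (zdGraph d) Λ β 0 .free) spinAt (a : Site d) b := by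
  classical
  set ι : ↥Λ ↪ Site d := Function.Embedding.subtype (· ∈ Λ) with hι
  have hmap : (univ : Finset ↥Λ).map ι = Λ := by
    rw [hι, Finset.univ_eq_attach, Finset.attach_map_val]
  have hadj : ∀ a ∈ (univ : Finset ↥Λ), ∀ b ∈ (univ : Finset ↥Λ),
      ((zdGraph d).Adj (ι a) (ι b) ↔ ((zdGraph d).comap (Subtype.val : ↥Λ → Site d)).Adj a b) :=
    fun _ _ _ _ => Iff.rfl
  have key := isingTwoPoint_free_map (G := (zdGraph d).comap (Subtype.val : ↥Λ → Site d))
    (G' := zdGraph d) ι (Λ := univ) hadj β 0 a b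
  rw [hmap] at key
  rw [twoPoint_isingMeasure, twoPoint_isingMeasure]
  exact key.symm

/-- TRANSPORT of the whole `U₄` combination. [CandidateProof] -/
theorem connectedFour_boxComap {d : ℕ} (Λ : Finset (Site d)) (β : ℝ) (a : Fin 4 → ↥Λ) :
    connectedFour (isingMeasure ((zdGraph d).comap (Subtype.val : ↥Λ → Site d)) univ β 0 .free) spinAt a =
      connectedFour (isingMeasure (zdGraph d) Λ β 0 .free) spinAt (fun i => (a i : Site d)) := by
  simp only [connectedFour, nPoint_boxComap, twoPoint_boxComap]

/-- CLOSED CONE: the defect inequality passes to the limit along any filter, given the seven limits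
(only the six PAIR limits are constrained). [CandidateProof] -/
theorem tetraDefect_le_of_tendsto' {ι : Type*} {l : Filter ι} [l.NeBot] {c u₀ : ℝ} {u : ι → ℝ}
    {g : ι → Fin 4 → Fin 4 → ℝ} {g₀ : Fin 4 → Fin 4 → ℝ}
    (hu : Tendsto u l (𝓝 u₀))
    (h01 : Tendsto (fun n => g n 0 1) l (𝓝 (g₀ 0 1))) (h23 : Tendsto (fun n => g n 2 3) l (𝓝 (g₀ 2 3)))
    (h02 : Tendsto (fun n => g n 0 2) l (𝓝 (g₀ 0 2))) (h13 : Tendsto (fun n => g n 1 3) l (𝓝 (g₀ 1 3)))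
    (h03 : Tendsto (fun n => g n 0 3) l (𝓝 (g₀ 0 3))) (h12 : Tendsto (fun n => g n 1 2) l (𝓝 (g₀ 1 2)))
    (h : ∀ᶠ n in l, u n - (g n 0 1 * g n 2 3 + g n 0 2 * g n 1 3 + g n 0 3 * g n 1 2) ≤
      -(c * (g n 0 1 * g n 2 3))) :
    u₀ - (g₀ 0 1 * g₀ 2 3 + g₀ 0 2 * g₀ 1 3 + g₀ 0 3 * g₀ 1 2) ≤ -(c * (g₀ 0 1 * g₀ 2 3)) :=
  le_of_tendsto_of_tendsto
    (hu.sub (((h01.mul h23).add (h02.mul h13)).add (h03.mul h12)))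
    ((h01.mul h23).const_mul c).neg h

end Transport

section StepB

open scoped Classical

/-- The dilated tetrahedron sits in every box of radius `≥ l`. [CandidateProof] -/
theorem smul_tetra_mem_box {l N : ℕ} (h : l ≤ N) (i : Fin 4) : (l : ℤ) • tetra i ∈ box 3 N := by
  rw [mem_box]
  intro k
  have hl : ((l : ℕ) : ℤ) ≤ N := by exact_mod_cast h
  fin_cases i <;> fin_cases k <;> simp [tetra] <;> omega

/-- The algebra of step (B) on a general finite graph: a joint-strand lower bound `c·Z·Z ≤ J` and the
(A)-inequality `U₄·(Z⁰)² ≤ -2J` give the defect inequality `U₄ ≤ -2c·⟨σσ⟩⟨σσ⟩`. [CandidateProof] -/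
theorem defect_of_join {V : Type*} [Fintype V] [DecidableEq V] (G : SimpleGraph V) [DecidableRel G.Adj]
    {β c J : ℝ} (hβ : 0 ≤ β) (a : Fin 4 → V) (ha : Function.Injective a)
    (hJ : c * loopO1PartitionFunction G (Real.tanh β) {a 0, a 1} *
      loopO1PartitionFunction G (Real.tanh β) {a 2, a 3} ≤ J)
    (hS : connectedFour (isingMeasure G Finset.univ β 0 .free) spinAt a *
      (loopO1PartitionFunction G (Real.tanh β) ∅) ^ 2 ≤ -(2 * J)) :
    connectedFour (isingMeasure G Finset.univ β 0 .free) spinAt a ≤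
      -(2 * c * (twoPoint (isingMeasure G Finset.univ β 0 .free) spinAt (a 0) (a 1) *
        twoPoint (isingMeasure G Finset.univ β 0 .free) spinAt (a 2) (a 3))) := by
  have ht : 0 ≤ Real.tanh β := by
    rw [Real.tanh_eq_sinh_div_cosh]
    exact div_nonneg (Real.sinh_nonneg_iff.2 hβ) (Real.cosh_pos β).le
  have hZ0 : 0 < loopO1PartitionFunction G (Real.tanh β) ∅ := loopO1PartitionFunction_empty_pos G ht
  have h2 : connectedFour (isingMeasure G Finset.univ β 0 .free) spinAt a *
      (loopO1PartitionFunction G (Real.tanh β) ∅) ^ 2 ≤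
      -(2 * c * (loopO1PartitionFunction G (Real.tanh β) {a 0, a 1} *
        loopO1PartitionFunction G (Real.tanh β) {a 2, a 3})) := by linarith
  rw [twoPoint_eq_loopO1_div hβ (ha.ne (by decide)), twoPoint_eq_loopO1_div hβ (ha.ne (by decide)),
    div_mul_div_comm, ← sq,
    show -(2 * c * (loopO1PartitionFunction G (Real.tanh β) {a 0, a 1} *
        loopO1PartitionFunction G (Real.tanh β) {a 2, a 3} / loopO1PartitionFunction G (Real.tanh β) ∅ ^ 2)) =
      -(2 * c * (loopO1PartitionFunction G (Real.tanh β) {a 0, a 1} *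
        loopO1PartitionFunction G (Real.tanh β) {a 2, a 3})) / loopO1PartitionFunction G (Real.tanh β) ∅ ^ 2
      by ring,
    le_div_iff₀ (pow_pos hZ0 2)]
  exact h2

/-- **STUB 4 · `stub_latticeBoundFromStrands`** — the route glue `LatticeBoundFromStrands`
(item 14648) BY NAME. Size M. FILLED: K1 at `N ≥ max N₀ l` + the inlined finite bound on the induced
box graph (`defect_of_join`), transport (`connectedFour_boxComap`), seven free box limits
(`criticalCorr_wellDefined_holds (d := 3)`, bc = free) through the closed cone. -/
theorem stub_latticeBoundFromStrands : LatticeBoundFromStrands := by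
  intro hK1 hSJB
  obtain ⟨c, hc, hK⟩ := hK1
  refine ⟨2 * c, by positivity, fun l hl => ?_⟩
  obtain ⟨N₀, hN⟩ := hK l hl
  have hl0 : ((l : ℕ) : ℤ) ≠ 0 := by exact_mod_cast (Nat.one_le_iff_ne_zero.1 hl)
  have hp : Function.Injective (fun i : Fin 4 => (l : ℤ) • tetra i) := fun i j h =>
    tetra_inj (smul_right_injective (Site 3) hl0 h)
  have hβ : 0 ≤ criticalBeta 3 := criticalBeta_nonneg 3
  -- the finite-volume inequality for `N ≥ max N₀ l`
  have hfin : ∀ N : ℕ, max N₀ l ≤ N →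
      isingExpect (zdGraph 3) (box 3 N) (criticalBeta 3) 0 .free (spinMonomial fun i : Fin 4 => (l : ℤ) • tetra i) -
          (isingExpect (zdGraph 3) (box 3 N) (criticalBeta 3) 0 .free (spinMonomial ![(l : ℤ) • tetra 0, (l : ℤ) • tetra 1]) *
              isingExpect (zdGraph 3) (box 3 N) (criticalBeta 3) 0 .free (spinMonomial ![(l : ℤ) • tetra 2, (l : ℤ) • tetra 3]) +
            isingExpect (zdGraph 3) (box 3 N) (criticalBeta 3) 0 .free (spinMonomial ![(l : ℤ) • tetra 0, (l : ℤ) • tetra 2]) *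
              isingExpect (zdGraph 3) (box 3 N) (criticalBeta 3) 0 .free (spinMonomial ![(l : ℤ) • tetra 1, (l : ℤ) • tetra 3]) +
            isingExpect (zdGraph 3) (box 3 N) (criticalBeta 3) 0 .free (spinMonomial ![(l : ℤ) • tetra 0, (l : ℤ) • tetra 3]) *
              isingExpect (zdGraph 3) (box 3 N) (criticalBeta 3) 0 .free (spinMonomial ![(l : ℤ) • tetra 1, (l : ℤ) • tetra 2])) ≤
        -(2 * c * (isingExpect (zdGraph 3) (box 3 N) (criticalBeta 3) 0 .free (spinMonomial ![(l : ℤ) • tetra 0, (l : ℤ) • tetra 1]) *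
          isingExpect (zdGraph 3) (box 3 N) (criticalBeta 3) 0 .free (spinMonomial ![(l : ℤ) • tetra 2, (l : ℤ) • tetra 3]))) := by
    intro N hNl
    have hN₀N : N₀ ≤ N := le_of_max_le_left hNl
    have hlN : l ≤ N := le_of_max_le_right hNl
    -- K1's configuration inside the box
    let a : Fin 4 → ↥(box 3 N) := fun i => ⟨(l : ℤ) • tetra i, smul_tetra_mem_box hlN i⟩
    have ha : ∀ i, ((a i : Site 3)) = (l : ℤ) • tetra i := fun i => rfl
    have hainj : Function.Injective a := fun i j h => hp (congrArg Subtype.val h)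
    -- K1 at `N` and the finite bound on the induced graph, combined on the induced graph
    have hU := defect_of_join ((zdGraph 3).comap (Subtype.val : ↥(box 3 N) → Site 3)) hβ a hainj
      (hN N hN₀N a ha) (hSJB _ ((zdGraph 3).comap (Subtype.val : ↥(box 3 N) → Site 3)) (criticalBeta 3) hβ a hainj)
    -- transport to the free box measure of `ℤ³`
    rw [connectedFour_boxComap (box 3 N) (criticalBeta 3) a, twoPoint_boxComap (box 3 N) (criticalBeta 3) (a 0) (a 1),
      twoPoint_boxComap (box 3 N) (criticalBeta 3) (a 2) (a 3)] at hU
    unfold connectedFour at hU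
    rw [nPoint_isingMeasure] at hU
    simp only [← isingExpect_spinMonomial_two] at hU
    have hU' : isingExpect (zdGraph 3) (box 3 N) (criticalBeta 3) 0 .free (spinMonomial fun i : Fin 4 => (l : ℤ) • tetra i) -
          isingExpect (zdGraph 3) (box 3 N) (criticalBeta 3) 0 .free (spinMonomial ![(l : ℤ) • tetra 0, (l : ℤ) • tetra 1]) *
            isingExpect (zdGraph 3) (box 3 N) (criticalBeta 3) 0 .free (spinMonomial ![(l : ℤ) • tetra 2, (l : ℤ) • tetra 3]) -
          isingExpect (zdGraph 3) (box 3 N) (criticalBeta 3) 0 .free (spinMonomial ![(l : ℤ) • tetra 0, (l : ℤ) • tetra 2]) *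
            isingExpect (zdGraph 3) (box 3 N) (criticalBeta 3) 0 .free (spinMonomial ![(l : ℤ) • tetra 1, (l : ℤ) • tetra 3]) -
          isingExpect (zdGraph 3) (box 3 N) (criticalBeta 3) 0 .free (spinMonomial ![(l : ℤ) • tetra 0, (l : ℤ) • tetra 3]) *
            isingExpect (zdGraph 3) (box 3 N) (criticalBeta 3) 0 .free (spinMonomial ![(l : ℤ) • tetra 1, (l : ℤ) • tetra 2]) ≤
        -(2 * c * (isingExpect (zdGraph 3) (box 3 N) (criticalBeta 3) 0 .free (spinMonomial ![(l : ℤ) • tetra 0, (l : ℤ) • tetra 1]) *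
          isingExpect (zdGraph 3) (box 3 N) (criticalBeta 3) 0 .free (spinMonomial ![(l : ℤ) • tetra 2, (l : ℤ) • tetra 3]))) := hU
    linarith
  -- the seven free box limits and the closed cone
  have hwd := criticalCorr_wellDefined_holds (d := 3) le_rfl
  have hfree : (BoundaryCondition.free : BoundaryCondition (Site 3)) ∈
      ({.free, .plus, .minus} : Set (BoundaryCondition (Site 3))) := by simp
  have key := tetraDefect_le_of_tendsto' (l := atTop) (c := 2 * c)
    (u₀ := criticalCorr 3 4 (fun i : Fin 4 => (l : ℤ) • tetra i))
    (g₀ := fun i j => criticalCorr 3 2 ![(l : ℤ) • tetra i, (l : ℤ) • tetra j])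
    (g := fun (N : ℕ) (i j : Fin 4) =>
      isingExpect (zdGraph 3) (box 3 N) (criticalBeta 3) 0 .free (spinMonomial ![(l : ℤ) • tetra i, (l : ℤ) • tetra j]))
    (hwd 4 (fun i : Fin 4 => (l : ℤ) • tetra i) .free hfree)
    (hwd 2 ![(l : ℤ) • tetra 0, (l : ℤ) • tetra 1] .free hfree) (hwd 2 ![(l : ℤ) • tetra 2, (l : ℤ) • tetra 3] .free hfree)
    (hwd 2 ![(l : ℤ) • tetra 0, (l : ℤ) • tetra 2] .free hfree) (hwd 2 ![(l : ℤ) • tetra 1, (l : ℤ) • tetra 3] .free hfree)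
    (hwd 2 ![(l : ℤ) • tetra 0, (l : ℤ) • tetra 3] .free hfree) (hwd 2 ![(l : ℤ) • tetra 1, (l : ℤ) • tetra 2] .free hfree)
    (Filter.eventually_atTop.2 ⟨max N₀ l, fun N hN => hfin N hN⟩)
  exact key

end StepB

/-! ### Consistency: each named statement IS its registered stub (definitionally) -/

theorem pairOddPartLaw_holds : PairOddPartLaw := stub_pairOddPartLaw
theorem aizenmanOddDomination_holds : AizenmanOddDomination := stub_aizenmanOddDomination
theorem strandsJoinOfLaw_holds : StrandsJoinOfLaw := stub_strandsJoinBound_of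
theorem latticeTransport_holds : LatticeTransport := stub_latticeBoundFromStrands

/-! ### Name-keyed aliases of the four statements (the hypotheses of the composition) -/
namespace Registered

/-- Alias of `PairOddPartLaw` keyed by the registered stub name. -/
abbrev stub_pairOddPartLaw : Prop := PairOddPartLaw
/-- Alias of `AizenmanOddDomination` keyed by the registered stub name. -/
abbrev stub_aizenmanOddDomination : Prop := AizenmanOddDomination
/-- Alias of `StrandsJoinOfLaw` keyed by the registered stub name. -/
abbrev stub_strandsJoinBound_of : Prop := StrandsJoinOfLaw
/-- Alias of `LatticeTransport` (= `LatticeBoundFromStrands`) keyed by the registered stub name. -/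
abbrev stub_latticeBoundFromStrands : Prop := LatticeTransport

end Registered

/-! ## §3 The composition — PROVED (no stub inside): stubs ⇒ crux BY NAME -/

/-- **`JoinForcesU4_of`** — the glue of the line: the pair law (S1) and the Aizenman/odd-part
domination (S2) give `StrandsJoinBound` (S3); the lattice transport (S4) turns the crux hypothesis
`IndependentStrandsJoin` into the tetrahedral lattice bound `U₄^crit(l•tetra) ≤ −c·G·G` for all `l ≥ 1`;
the LANDED item 4471 (`farMergingGivesU4_proof`, dilations `L = max L₀ 1`, shape `tetra`) concludes
`HasNontrivialU4 S` for every non-degenerate pointwise limit — i.e. the crux decl `JoinForcesU4`. -/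
theorem JoinForcesU4_of (h₁ : Registered.stub_pairOddPartLaw) (h₂ : Registered.stub_aizenmanOddDomination)
    (h₃ : Registered.stub_strandsJoinBound_of) (h₄ : Registered.stub_latticeBoundFromStrands) :
    Summit.CriticalPhenomena.Ising3DConformalLimit.Theses.FKParityRobustness.JoinForcesU4 := by
  intro hK1 ρ S hρ hlim hnd
  obtain ⟨c, hc, hlat⟩ := h₄ hK1 (h₃ h₁ h₂)
  exact Summit.CriticalPhenomena.Ising3DConformalLimit.FKParityRobustnessFarMergingGivesU4.farMergingGivesU4_proof
    ⟨c, hc, tetra, tetra_inj, fun L₀ => ⟨max L₀ 1, le_max_left _ _, hlat (max L₀ 1) (le_max_right _ _)⟩⟩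
    ρ S hρ hlim hnd

/-- Wiring check: the registered stubs feed `JoinForcesU4_of` as stated (the verbatim restatements are
definitionally the named statements). In this FILLED certificate it is the crux itself. -/
theorem joinForcesU4_holds :
    Summit.CriticalPhenomena.Ising3DConformalLimit.Theses.FKParityRobustness.JoinForcesU4 :=
  JoinForcesU4_of stub_pairOddPartLaw stub_aizenmanOddDomination stub_strandsJoinBound_of
    stub_latticeBoundFromStrands

/-- Support item 14647 `StrandsJoinBound`, from S1–S3. -/
theorem strandsJoinBound_holds : StrandsJoinBound :=
  stub_strandsJoinBound_of stub_pairOddPartLaw stub_aizenmanOddDomination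

/-- Support item 14648 `LatticeBoundFromStrands`, = S4. -/
theorem latticeBoundFromStrands_holds : LatticeBoundFromStrands := stub_latticeBoundFromStrands

/-! ## §4 Disproof / Negative knowledge honoured — see the module docstring; the landed lemmas
`Summit.CriticalPhenomena.Ising3DConformalLimit.Theorems.JoinForcesU4.Negative.not_crux_imp_not_support`
(`¬ JoinForcesU4 → ¬ StrandsJoinBound ∨ ¬ LatticeBoundFromStrands`: a refutation breaks the target of S3 or S4),
`withoutNondegeneracy_iff_not_strandsJoin`, `withoutLimit_iff_not_strandsJoin`, `iff_withoutPositivity` of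
`Theorems/JoinForcesU4/Negative/LoadBearing.lean` are cited, not imported (module not yet built on the farm
at planning time). -/

end Summit.CriticalPhenomena.Ising3DConformalLimit.Cruxes.JoinForcesU4.OddPartFubini

end
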